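/-
Origin: expansion seat `planner-pub-hodgecm-mc-axioms-1-g14-0`, handover #W74 2026-08-20T15:53:55Z md5 c4d6464f1afc (PKG 18db358efd03 → c4d6464f1afc; 98 l.; MECHANICAL (iib-R) rewrite v3.1 of the PKG file as it stands (15 token edits; rules R1x1+RX[h₂]x14)) (`HOME/mc/pub-hodgecm-mc-axioms-1-g14/revendor/kit-r55/stage55/HodgeCM/Model/UniverseKernel.lean`, md5 c4d6464f1afc, 98 lines);
landed by the gen-22 packager (p-g22) in gate run 55 REPLACES the earlier landed copy of `HodgeCM/Model/UniverseKernel.lean` (seat copy carried the packager Origin header of an earlier run (stripped)).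
-/
/-
Origin: CONSTRUCTION seat `planner-pub-hodgecm-mc-period-1-g5-0` (unit pub-hodgecm-mc-period-1-g5, gen 5 of
mc-period-1, period lane), 2026-08-19.  NEW additive PKG leaf `HodgeCM/Model/UniverseKernel.lean` = the G1 reading-A
leaf «PACKET 3K» of BINDER-TRIAGE §18.4 (carver ruling G1, 2026-08-18T20:12:46Z, GO-pre-authorised), written once the
V-betti packet (kit `mc/pub-hodgecm-mc-period-1-g4/t35-mcperiod1g4.txt` 9a8f22dcc0f0, rows #1–#1081 = the G-kernel
cone) made it cost ZERO further vendored twins.  Imports: INSTALLED `HodgeCM.Model.Universe` (mc-axioms-3 G0-d) and the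
t35 twin #1081 `Vendored/H21/AlgebraicGeometry/HodgeTheory/BettiUniverseHodgeRiemann` (987ecbb939f9), which itself
imports the twins #103 `ComplexConjugationHolds` (436d354aef54) and #521 `HodgeFiltrationModelsReductionProofs`
(c6bfc59bd68d).  INSTALL ORDER: after t35 row #1081 (or after the whole packet).  Nothing imports this file: if it is
not installed, every `Model.perL_picardCM_rN hHD hI …` headline stands unchanged (reading C).
KERNEL only: 1 `abbrev`, 7 theorems, 0 `structure` / `axiom`, no proof holes; expected `#print axioms` of every declaration
= {propext, Classical.choice, Quot.sound}.  No cite records (the three discharged rows are GU = 0 MODEL-N rows).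
-/
import Summits.HodgeConjecture.HodgeCM.Model.Universe
import Literature.AlgebraicGeometry.HodgeTheory.BettiUniverseHodgeRiemann

/-!
# The Picard–CM model universe with the three G-kernel rows discharged IN KERNEL (G1 reading A)

`HodgeCM.Model.picardCMUniverse hHD hI h₁ h₃` (`Model/Universe.lean`) takes, besides the three cited records
(ii-a) `BallQuotientUniformised`, (ii-b) `SpecialCyclesAlgebraic`, (iii) `CMAbelianVarietyRealised` of
`PicardCMPrerequisites`, the two Hodge-theoretic rows

* `hHD : exists_isReal_hodgeModel` (R-HD: the Hodge decomposition of a smooth projective variety with its real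
  structure) and
* `hI : hodgePQ_independent_of_hodgeModel` (R-I: model-independence of `H^{p,q}`),

and the E2 instance additionally the row

* `hHR : BettiUniverse.HodgeRiemann20` (R-HR20: Hodge–Riemann for `(2,0)`-classes on a surface).

All three are THEOREMS of the harness tree — `exists_isReal_hodgeModel_holds` (`HodgeTheory/ComplexConjugationHolds`),
`hodgePQ_independent_of_hodgeModel_holds` (`HodgeTheory/HodgeFiltrationModelsReductionProofs`),
`BettiUniverse.HodgeRiemann20_holds` (`HodgeTheory/BettiUniverseHodgeRiemann`) — whose vendored twins are rows
#103 / #521 / #1081 of the V-betti packet.  This leaf instantiates the universe at them: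

* `Model.picardCMUniverseK h₁ h₃` — an `abbrev` for
  `picardCMUniverse exists_isReal_hodgeModel_holds hodgePQ_independent_of_hodgeModel_holds h₁ h₃`;
* `Model.modelAxiomsPerLK`, `Model.tr_degreeK`, `Model.hodgeRiemann20K` — the `Universe.lean` facts on it, the last
  one with `hHR` DISCHARGED;
* `Model.hHD_holds`, `Model.hI_holds`, `Model.hHR_holds` — the three rows re-exported under `HodgeCM.Model` by the
  binder names the E files use, so that the END-STATE corollary of a revision `Model.perL_picardCM_rN` (kept GENERAL,
  as the theorem of record) is the one-line specialisation
  `Model.perL_picardCM_rN hHD_holds hI_holds h₁ h₃ … : (picardCMUniverseK h₁ h₃).PerL`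
  (`rfl` on the universe; `hHR_holds` fills the binder `hHR` of revisions that still carry it).  That corollary
  imports an E file and therefore lives with the E revision, not here.
-/

noncomputable section

namespace HodgeCM

namespace Model

open Literature.NumberTheory.Automorphic.PicardCM
open Literature.AlgebraicGeometry.HodgeTheory

/-- R-HD, closed in kernel: the row `hHD` of `picardCMUniverse`. -/
theorem hHD_holds : exists_isReal_hodgeModel := exists_isReal_hodgeModel_holds

/-- R-I, closed in kernel: the row `hI` of `picardCMUniverse`. -/
theorem hI_holds : hodgePQ_independent_of_hodgeModel := hodgePQ_independent_of_hodgeModel_holds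

/-- R-HR20, closed in kernel: the E binder `hHR`. -/
theorem hHR_holds : BettiUniverse.HodgeRiemann20 := BettiUniverse.HodgeRiemann20_holds

variable (h₁ : BallQuotientUniformised)  (h₃ : CMAbelianVarietyRealised)

/-- **The Picard–CM model universe over the three cited records only** — `picardCMUniverse` at the kernel
witnesses of R-HD and R-I (G1 reading A). -/
abbrev picardCMUniverseK : Universe :=
  picardCMUniverse hHD_holds hI_holds h₁ h₃

/-- (Ported verbatim from the HodgeCMPerL package; no docstring in the source.) -/
theorem picardCMUniverseK_eq :
    picardCMUniverseK h₁ h₃ = picardCMUniverse hHD_holds hI_holds h₁ h₃ := rfl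

/-- `M₅ : U.ModelAxiomsPerL` for the kernel-instantiated model universe. -/
theorem modelAxiomsPerLK : (picardCMUniverseK h₁ h₃).ModelAxiomsPerL :=
  modelAxiomsPerL hHD_holds hI_holds h₃ h₁

/-- `Fact_tr_degree` for the kernel-instantiated model universe. -/
theorem tr_degreeK : (picardCMUniverseK h₁ h₃).Fact_tr_degree :=
  tr_degree hHD_holds hI_holds h₃ h₁

/-- `Fact_hodgeRiemann20` for the kernel-instantiated model universe — `hHR` DISCHARGED by
`BettiUniverse.HodgeRiemann20_holds`. -/
theorem hodgeRiemann20K : (picardCMUniverseK h₁ h₃).Fact_hodgeRiemann20 :=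
  hodgeRiemann20 hHD_holds hI_holds h₃ h₁ hHR_holds

end Model

end HodgeCM

end
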